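import Summits.ValiantsHypothesis.ValiantsHypothesis.Theses.TwistedDetRank
import Literature.Computability.AlgebraicComplexity.SymmetricArithCircuit

/-!
# Skeleton `birth` for crux `TwistedDetRank.SliceVBPFermionic` (stmt-ValiantsHypothesis-17991; X2b of
# the VBP redirect of `FermionicNormalForm`) — symmetrise the determinantal representation, then read
# the fermionic normal form off the symmetric object

X2b ("a class-function GMF family of p-bounded affine determinantal complexity is, for `n ≥ 1`, a sum
of quasi-polynomially many Hadamard-twisted determinants") is factored through S_n-SYMMETRIC
computation (Dawar–Wilsenach: labelled circuits on the variable matrix all of whose relabellings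
`x_ij ↦ x_{πi,πj}` extend to circuit automorphisms — exactly the symmetry of a class-function GMF):

* `stub_restorationVBP` (RESTORATION OF SYMMETRY FROM A SMALL DETERMINANTAL REPRESENTATION): a
  class-function GMF family with `dc ≤ n^k + k` has S_n-symmetric labelled circuits of
  quasi-polynomial size.  This is the VBP-restriction of the staffed crux
  `ProofCarryingSymmetry.RestorationQP` (stmt-ValiantsHypothesis-10343, which asks it for all of VP and
  is summit-hard); restricted to VBP inputs it is NOT summit-hard — with the proved
  `SquareSymmetricPermLB` (Dawar–Wilsenach Thm 7.1, in tree) it yields only `DcPerSuperpolynomial ℂ`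
  (`VNP ⊄ VBP`), and it is consistent with `VP = VNP`.  Why plausible: a determinantal representation
  is a far more rigid object than a circuit — Landsberg 2017 §7.4.1 / Landsberg–Ressayre 2017 single
  out exactly "an equivariant determinantal expression of size polynomial in dc" as the missing step
  of the det-vs-per programme; on the class-function slice the group is only the diagonal S_n, whose
  quasi-polynomial-dimensional representations are the low-depth ones, and averaging a size-`n^k`
  representation over S_n/stabiliser is the graded `n^{O(k)}`-per-level mechanism the redirect needs.
* `stub_symmetricFermionic` (SYMMETRIC ⇒ FERMIONIC): a class-function GMF family with S_n-symmetric
  circuits of quasi-polynomial size is, for `n ≥ 1`, a quasi-polynomial sum of twisted determinants.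
  = SymA ∘ B of line `symmetric` of the parent crux (SymA: symmetric-cheap ⇒ quasi-local coefficients,
  via supports / counting width, Dawar–Wilsenach Thm 6.4 and Dawar–Pago–Seppelt 2025 Thm 3.5 — its
  instances `χ ≡ 1` and irreducible `χ^λ` are theorems; B = `LocalGeneratorsSmallTdr`, LANDED).
  VH-free.
* composition `SliceVBPFermionic_of` (kernel-checked).

Neither stub is the crux or the summit: restoration concludes symmetric size, not tdr; the second
stub assumes it; each is consistent with `VP ℂ = VNP ℂ`.
-/

noncomputable section

namespace Summit.ValiantsHypothesis.ValiantsHypothesis.Cruxes.SliceVBPFermionic.Birth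

open Literature.Computability.AlgebraicComplexity
open Summit.ValiantsHypothesis.ValiantsHypothesis.Theses.TwistedDetRank

/-- STUB (restoration of symmetry on the VBP slice): a class-function GMF family with affine
determinantal representations of p-bounded size has `S_n`-symmetric labelled arithmetic circuits
(diagonal action on `Fin n × Fin n`, trivial on the single output) of quasi-polynomial size.
[open; LandsbergRessayre2017, Landsberg2017 §7.4.1, DawarWilsenach2025, DawarPagoSeppelt2025] -/
theorem stub_restorationVBP :
    ∀ χ : (n : ℕ) → Equiv.Perm (Fin n) → ℂ,
      (∀ (n : ℕ) (σ τ : Equiv.Perm (Fin n)), χ n (τ * σ * τ⁻¹) = χ n σ) →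
      (∃ c : ℕ, ∀ n : ℕ, ∃ m ≤ n ^ c + c,
        HasDetRepr (∑ σ : Equiv.Perm (Fin n),
          MvPolynomial.C (χ n σ) * ∏ i : Fin n, (MvPolynomial.X (σ i, i) : MvPolynomial (Fin n × Fin n) ℂ)) m) →
      ∃ c : ℕ, ∀ n : ℕ, ∃ (G : Type) (_ : Fintype G)
        (C : LabelledArithCircuit ℂ (Fin n × Fin n) Unit G),
        C.IsSymmetric (Equiv.Perm (Fin n)) ∧
        C.eval (C.output ()) = (∑ σ : Equiv.Perm (Fin n),
          MvPolynomial.C (χ n σ) * ∏ i : Fin n, (MvPolynomial.X (σ i, i) : MvPolynomial (Fin n × Fin n) ℂ)) ∧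
        Fintype.card G ≤ 2 ^ ((Nat.log 2 n + c) ^ c) := by
  sorry

/-- STUB (symmetric ⇒ fermionic): a class-function GMF family with `S_n`-symmetric circuits of
quasi-polynomial size is, for `n ≥ 1`, a sum of quasi-polynomially many twisted determinants
(= SymA ∘ B of line `symmetric` of crux `FermionicNormalForm`; B is landed).
[open; DawarWilsenach2025 Thm 6.4, DawarPagoSeppelt2025 Thm 3.5, Curticapean2021, MarcusMinc1961] -/
theorem stub_symmetricFermionic :
    ∀ χ : (n : ℕ) → Equiv.Perm (Fin n) → ℂ,
      (∀ (n : ℕ) (σ τ : Equiv.Perm (Fin n)), χ n (τ * σ * τ⁻¹) = χ n σ) →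
      (∃ c : ℕ, ∀ n : ℕ, ∃ (G : Type) (_ : Fintype G)
        (C : LabelledArithCircuit ℂ (Fin n × Fin n) Unit G),
        C.IsSymmetric (Equiv.Perm (Fin n)) ∧
        C.eval (C.output ()) = (∑ σ : Equiv.Perm (Fin n),
          MvPolynomial.C (χ n σ) * ∏ i : Fin n, (MvPolynomial.X (σ i, i) : MvPolynomial (Fin n × Fin n) ℂ)) ∧
        Fintype.card G ≤ 2 ^ ((Nat.log 2 n + c) ^ c)) →
      ∃ c : ℕ, ∀ n : ℕ, 1 ≤ n → ∃ r ≤ 2 ^ ((Nat.log 2 n + c) ^ c), ∃ E : Fin r → Matrix (Fin n) (Fin n) ℂ,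
        (∑ σ : Equiv.Perm (Fin n), MvPolynomial.C (χ n σ) *
            ∏ i : Fin n, (MvPolynomial.X (σ i, i) : MvPolynomial (Fin n × Fin n) ℂ)) =
          ∑ t, (Matrix.of fun i j => MvPolynomial.C (E t i j) * MvPolynomial.X (i, j)).det := by
  sorry

/-- COMPOSITION: the two stubs give the crux `SliceVBPFermionic` (by name). [this skeleton] -/
theorem SliceVBPFermionic_of : SliceVBPFermionic :=
  fun χ hχ hdc => stub_symmetricFermionic χ hχ (stub_restorationVBP χ hχ hdc)

end Summit.ValiantsHypothesis.ValiantsHypothesis.Cruxes.SliceVBPFermionic.Birth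

end
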